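import Mathlib
import HarnessLib
import Summits.Ventures.LatticeQCDFlow.Exactness.SU2WilsonFlowLOMeanAcceptance
import Summits.Ventures.LatticeQCDFlow.Exactness.SU2ResidualExactForceRegular
import Summits.Ventures.LatticeQCDFlow.Exactness.SU2ResidualExactForceCovering
import Summits.Ventures.LatticeQCDFlow.Exactness.SU2FTHMCGaugeCovarianceMembers

/-!
# THE MEAN ACCEPTANCE OF FT-HMC THROUGH THE LEARNED `SU(2)` RESIDUAL MEMBER WITH THE EXACT FORCE AS RUN IS `≥ 1 − O(nε'²)`: the «acceptance vs step size» law of the trained member, averaged over the momentum refresh — any torus, any schedule of residual layers with a smooth conditioner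

HONEST FRAMING: exact (Metropolis-corrected) sampling algorithms for lattice gauge theory;
figures of merit are autocorrelation/cost numbers at stated couplings and volumes; no
continuum-physics claim.

Venture `LatticeQCDFlow` (cell pub-lqcd), topic `Exactness`; FANOUT row 14 (`eng-flowhmc`, engine
`latflow.fthmc`, family B, the LEARNED member `maps.residual_trained_scan` — the «learned map inside HMC» of the row's
title).  NEW WORK of the cell — the assembly for the trained member: `SU2WilsonFlowLOMeanAcceptance` §1
(`su2LeapfrogProposalN_meanAcceptance_ge_of_unitGrad`: generic unit-gradient mean-acceptance law),
`SU2ResidualExactForceRegular` (`su2Residual_exactForce_regular`: under (ρC) the exact force `Φ₁ = D¹S̃` of the learned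
member is measurable, bounded, matrix-sup-Lipschitz), `SU2ResidualExactForceCovering`
(`differentiableAt_ftAction_su2Residual_pauliDrift` under (ρD)), `SU2FTHMCGaugeCovarianceMembers` (`measurable_foldr_logDet`),
`WilsonHeatBathErgodic` (`continuous_smul_wilsonAction`); nothing is cited as a fact; no number.

* **`su2Residual_exactForce_meanAcceptance_ge`** — torus `(ℤ/L)^d`, colouring `χ`, layer specs `(μf, bf, cf, ρf)` with
  (ρC) and (ρD), ANY schedule `sched` (layers packaged VERBATIM as in `exists_layers_su2Residual`, positive MEASURABLE
  densities), every `β`, `κ' > 0`: there are `Φ_max, K_Φ ≥ 0` such that for EVERY `n`, `ε'`, `q` the refresh-averaged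
  Metropolis acceptance of the engine's `n`-step proposal with drift `e_{ε'}` and the consistent half kick
  `−(ε'/(4κ'))·D¹S̃` is at least
  `1 − n·(|ε'|K_Φ)·|ε'|·(8|E|²·3/(2κ') + (8b + 8c₁ + c₂)·|E|·2/√(πκ') + b(8c₁ + c₂))`,
  `b = (2n+1)|ε'|Φ_max/(4κ')`, `c₁ = (2n+1)|E||ε'|Φ_max/(4κ')`, `c₂ = |E||ε'|Φ_max/κ'` — `1 − O(nε'²)`.

NOT CLAIMED: that a given checkpoint's network meets (ρC)/(ρD) (smooth activations do; `LatticeStencilSmooth` reduces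
both to the raw feature map and readout); any value of `Φ_max`, `K_Φ`; volume-uniform constants; floating point; any
number.
-/

noncomputable section

namespace Summit.Ventures.LatticeQCDFlow.Exactness

open Set Function MeasureTheory NormedSpace InnerProductGeometry
open Literature.MathematicalPhysics.QuantumFieldTheory
open Literature.MathematicalPhysics.QuantumFieldTheory.Balaban1983to89.B10Eq18SigmaSU2Haar (expPauli)
open scoped Matrix Matrix.Norms.Operator InnerProductSpace ENNReal

set_option backward.isDefEq.respectTransparency false

section Residual

variable {d L : ℕ} {X σ : Type*} [DecidableEq X] (χ : Site d L → X) [NeZero L]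
  (μf : σ → Fin d) (bf : σ → X) (cf : σ → ℝ)
  (ρf : σ → GaugeConfig d L (Matrix.specialUnitaryGroup (Fin 2) ℂ) → Edge d L → Fin d → Fin 2 → ℝ)

/-- **THE MEAN ACCEPTANCE OF FT-HMC THROUGH THE LEARNED `SU(2)` RESIDUAL MEMBER WITH THE EXACT FORCE AS RUN.**
(ρC) + (ρD), ANY schedule of residual layer specs (layers packaged VERBATIM, positive measurable densities), every
`β`, `κ' > 0`: there are `Φ_max, K_Φ ≥ 0` such that for EVERY `n`, `ε'`, `q` the refresh-averaged Metropolis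
acceptance is `≥ 1 − n·(|ε'|K_Φ)·|ε'|·(8|E|²·3/(2κ') + (8b + 8c₁ + c₂)·|E|·2/√(πκ') + b(8c₁ + c₂))`. -/
theorem su2Residual_exactForce_meanAcceptance_ge
    (hρ : ∀ {n : WithTop ℕ∞} (s : σ) (U : (Edge d L → Matrix (Fin 2) (Fin 2) ℂ) × (Edge d L → EuclideanSpace ℝ (Fin 3)) → GaugeConfig d L (Matrix.specialUnitaryGroup (Fin 2) ℂ)) (p₀ : (Edge d L → Matrix (Fin 2) (Fin 2) ℂ) × (Edge d L → EuclideanSpace ℝ (Fin 3))), (∀ e : Edge d L, ContDiffAt ℝ n (fun p : (Edge d L → Matrix (Fin 2) (Fin 2) ℂ) × (Edge d L → EuclideanSpace ℝ (Fin 3)) => ((U p e : (Matrix.specialUnitaryGroup (Fin 2) ℂ)) : Matrix (Fin 2) (Fin 2) ℂ)) p₀) →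
      ∀ (e : Edge d L) (ν : Fin d) (b : Fin 2), ContDiffAt ℝ n (fun p : (Edge d L → Matrix (Fin 2) (Fin 2) ℂ) × (Edge d L → EuclideanSpace ℝ (Fin 3)) => ρf s (U p) e ν b) p₀)
    (hρD : ∀ (s : σ) (U : (Edge d L → EuclideanSpace ℝ (Fin 3)) → GaugeConfig d L (Matrix.specialUnitaryGroup (Fin 2) ℂ))
      (p₀ : Edge d L → EuclideanSpace ℝ (Fin 3)),
      (∀ e : Edge d L, DifferentiableAt ℝ (fun p => ((U p e : (Matrix.specialUnitaryGroup (Fin 2) ℂ)) : Matrix (Fin 2) (Fin 2) ℂ)) p₀) →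
      ∀ (e : Edge d L) (ν : Fin d) (b : Fin 2), DifferentiableAt ℝ (fun p => ρf s (U p) e ν b) p₀)
    (sched : List σ)
    (layers : List ((GaugeConfig d L (Matrix.specialUnitaryGroup (Fin 2) ℂ) ≃ᵐ GaugeConfig d L (Matrix.specialUnitaryGroup (Fin 2) ℂ)) × (GaugeConfig d L (Matrix.specialUnitaryGroup (Fin 2) ℂ) → ℝ)))
    (hmap :
      layers.map (fun Ly => ((Ly.1 : GaugeConfig d L (Matrix.specialUnitaryGroup (Fin 2) ℂ) → GaugeConfig d L (Matrix.specialUnitaryGroup (Fin 2) ℂ)), Ly.2)) =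
        sched.map (fun s =>
          ((fun (V : GaugeConfig d L (Matrix.specialUnitaryGroup (Fin 2) ℂ)) (e : Edge d L) =>
        if e.2 = μf s ∧ χ e.1 = bf s then
          gaussUnit (geodesicKick (cf s) (∑ ν ∈ Finset.univ.erase e.2,
            (ρf s V e ν 0 • vecQuat (((V (Site.shift e.1 e.2, ν) * (V (Site.shift e.1 ν, e.2))⁻¹ * (V (e.1, ν))⁻¹)⁻¹ : Matrix.specialUnitaryGroup (Fin 2) ℂ) : Matrix (Fin 2) (Fin 2) ℂ) +
              ρf s V e ν 1 • vecQuat ((((V (Site.shift (e.1 - Pi.single ν 1) e.2, ν))⁻¹ * (V (e.1 - Pi.single ν 1, e.2))⁻¹ * V (e.1 - Pi.single ν 1, ν))⁻¹ : Matrix.specialUnitaryGroup (Fin 2) ℂ) : Matrix (Fin 2) (Fin 2) ℂ)))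
            (vecQuat ((V e : Matrix.specialUnitaryGroup (Fin 2) ℂ) : Matrix (Fin 2) (Fin 2) ℂ)))
        else V e),
           fun V : GaugeConfig d L (Matrix.specialUnitaryGroup (Fin 2) ℂ) => ∏ a : {e : Edge d L // e.2 = μf s ∧ χ e.1 = bf s},
          (if Real.sin (angle (∑ ν ∈ Finset.univ.erase a.1.2,
            (ρf s V a.1 ν 0 • vecQuat (((V (Site.shift a.1.1 a.1.2, ν) * (V (Site.shift a.1.1 ν, a.1.2))⁻¹ * (V (a.1.1, ν))⁻¹)⁻¹ : Matrix.specialUnitaryGroup (Fin 2) ℂ) : Matrix (Fin 2) (Fin 2) ℂ) +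
              ρf s V a.1 ν 1 • vecQuat ((((V (Site.shift (a.1.1 - Pi.single ν 1) a.1.2, ν))⁻¹ * (V (a.1.1 - Pi.single ν 1, a.1.2))⁻¹ * V (a.1.1 - Pi.single ν 1, ν))⁻¹ : Matrix.specialUnitaryGroup (Fin 2) ℂ) : Matrix (Fin 2) (Fin 2) ℂ))) (vecQuat ((V a.1 : Matrix.specialUnitaryGroup (Fin 2) ℂ) : Matrix (Fin 2) (Fin 2) ℂ))) = 0 then
            (1 - cf s * ‖(∑ ν ∈ Finset.univ.erase a.1.2,
            (ρf s V a.1 ν 0 • vecQuat (((V (Site.shift a.1.1 a.1.2, ν) * (V (Site.shift a.1.1 ν, a.1.2))⁻¹ * (V (a.1.1, ν))⁻¹)⁻¹ : Matrix.specialUnitaryGroup (Fin 2) ℂ) : Matrix (Fin 2) (Fin 2) ℂ) +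
              ρf s V a.1 ν 1 • vecQuat ((((V (Site.shift (a.1.1 - Pi.single ν 1) a.1.2, ν))⁻¹ * (V (a.1.1 - Pi.single ν 1, a.1.2))⁻¹ * V (a.1.1 - Pi.single ν 1, ν))⁻¹ : Matrix.specialUnitaryGroup (Fin 2) ℂ) : Matrix (Fin 2) (Fin 2) ℂ)))‖ * Real.cos (angle (∑ ν ∈ Finset.univ.erase a.1.2,
            (ρf s V a.1 ν 0 • vecQuat (((V (Site.shift a.1.1 a.1.2, ν) * (V (Site.shift a.1.1 ν, a.1.2))⁻¹ * (V (a.1.1, ν))⁻¹)⁻¹ : Matrix.specialUnitaryGroup (Fin 2) ℂ) : Matrix (Fin 2) (Fin 2) ℂ) +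
              ρf s V a.1 ν 1 • vecQuat ((((V (Site.shift (a.1.1 - Pi.single ν 1) a.1.2, ν))⁻¹ * (V (a.1.1 - Pi.single ν 1, a.1.2))⁻¹ * V (a.1.1 - Pi.single ν 1, ν))⁻¹ : Matrix.specialUnitaryGroup (Fin 2) ℂ) : Matrix (Fin 2) (Fin 2) ℂ))) (vecQuat ((V a.1 : Matrix.specialUnitaryGroup (Fin 2) ℂ) : Matrix (Fin 2) (Fin 2) ℂ)))) ^ 3
          else kickJac (cf s * ‖(∑ ν ∈ Finset.univ.erase a.1.2,
            (ρf s V a.1 ν 0 • vecQuat (((V (Site.shift a.1.1 a.1.2, ν) * (V (Site.shift a.1.1 ν, a.1.2))⁻¹ * (V (a.1.1, ν))⁻¹)⁻¹ : Matrix.specialUnitaryGroup (Fin 2) ℂ) : Matrix (Fin 2) (Fin 2) ℂ) +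
              ρf s V a.1 ν 1 • vecQuat ((((V (Site.shift (a.1.1 - Pi.single ν 1) a.1.2, ν))⁻¹ * (V (a.1.1 - Pi.single ν 1, a.1.2))⁻¹ * V (a.1.1 - Pi.single ν 1, ν))⁻¹ : Matrix.specialUnitaryGroup (Fin 2) ℂ) : Matrix (Fin 2) (Fin 2) ℂ)))‖) 2 (angle (∑ ν ∈ Finset.univ.erase a.1.2,
            (ρf s V a.1 ν 0 • vecQuat (((V (Site.shift a.1.1 a.1.2, ν) * (V (Site.shift a.1.1 ν, a.1.2))⁻¹ * (V (a.1.1, ν))⁻¹)⁻¹ : Matrix.specialUnitaryGroup (Fin 2) ℂ) : Matrix (Fin 2) (Fin 2) ℂ) +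
              ρf s V a.1 ν 1 • vecQuat ((((V (Site.shift (a.1.1 - Pi.single ν 1) a.1.2, ν))⁻¹ * (V (a.1.1 - Pi.single ν 1, a.1.2))⁻¹ * V (a.1.1 - Pi.single ν 1, ν))⁻¹ : Matrix.specialUnitaryGroup (Fin 2) ℂ) : Matrix (Fin 2) (Fin 2) ℂ))) (vecQuat ((V a.1 : Matrix.specialUnitaryGroup (Fin 2) ℂ) : Matrix (Fin 2) (Fin 2) ℂ)))))))
    (hpos : ∀ Ly ∈ layers, ∀ V, 0 < Ly.2 V) (hJm : ∀ Ly ∈ layers, Measurable Ly.2) (β κ' : ℝ) (hκ' : 0 < κ') :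
    ∃ Φmax KΦ : ℝ, 0 ≤ Φmax ∧ 0 ≤ KΦ ∧
      ∀ (n : ℕ) (ε' : ℝ) (q : GaugeConfig d L (Matrix.specialUnitaryGroup (Fin 2) ℂ)),
        1 - n * ((|ε'| * KΦ) * |ε'|) *
            (8 * ((Fintype.card (Edge d L) : ℝ) ^ 2 * (3 / (2 * κ'))) +
              (8 * ((2 * n + 1) * (|ε'| * Φmax / (4 * κ'))) + 8 * ((2 * n + 1) * (Fintype.card (Edge d L) * (|ε'| * Φmax / (4 * κ')))) +
                  Fintype.card (Edge d L) * (|ε'| * Φmax) / κ') * (Fintype.card (Edge d L) * (2 / Real.sqrt (Real.pi * κ'))) +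
              (2 * n + 1) * (|ε'| * Φmax / (4 * κ')) *
                (8 * ((2 * n + 1) * (Fintype.card (Edge d L) * (|ε'| * Φmax / (4 * κ')))) + Fintype.card (Edge d L) * (|ε'| * Φmax) / κ')) ≤
          ∫ p, min 1 (Real.exp (-((β * wilsonAction (Matrix.specialUnitaryGroup (Fin 2) ℂ).subtype ((layers.foldr (fun Ly (F : GaugeConfig d L (Matrix.specialUnitaryGroup (Fin 2) ℂ) ≃ᵐ GaugeConfig d L (Matrix.specialUnitaryGroup (Fin 2) ℂ)) => Ly.1.trans F) (MeasurableEquiv.refl (GaugeConfig d L (Matrix.specialUnitaryGroup (Fin 2) ℂ)))) (sunLeapfrogProposalN pauliCoordι pauliCoordι_skew ε' (fun (V : GaugeConfig d L (Matrix.specialUnitaryGroup (Fin 2) ℂ)) (l : Edge d L) => -(ε' / (4 * κ')) • WithLp.toLp 2 (fun i : Fin 3 =>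
        fderiv ℝ (fun a : Edge d L → EuclideanSpace ℝ (Fin 3) => β * wilsonAction (Matrix.specialUnitaryGroup (Fin 2) ℂ).subtype ((layers.foldr (fun Ly (F : GaugeConfig d L (Matrix.specialUnitaryGroup (Fin 2) ℂ) ≃ᵐ GaugeConfig d L (Matrix.specialUnitaryGroup (Fin 2) ℂ)) => Ly.1.trans F) (MeasurableEquiv.refl (GaugeConfig d L (Matrix.specialUnitaryGroup (Fin 2) ℂ)))) ((fun l : Edge d L => expPauli (a l)) * V)) - Real.log ((layers.foldr (fun Ly K => fun v => Ly.2 v * K (Ly.1 v)) (fun _ => (1 : ℝ))) ((fun l : Edge d L => expPauli (a l)) * V))) 0 (Pi.single l (EuclideanSpace.single i (1 : ℝ))))) n (q, p)).1) - Real.log ((layers.foldr (fun Ly K => fun v => Ly.2 v * K (Ly.1 v)) (fun _ => (1 : ℝ))) (sunLeapfrogProposalN pauliCoordι pauliCoordι_skew ε' (fun (V : GaugeConfig d L (Matrix.specialUnitaryGroup (Fin 2) ℂ)) (l : Edge d L) => -(ε' / (4 * κ')) • WithLp.toLp 2 (fun i : Fin 3 =>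
        fderiv ℝ (fun a : Edge d L → EuclideanSpace ℝ (Fin 3) => β * wilsonAction (Matrix.specialUnitaryGroup (Fin 2) ℂ).subtype ((layers.foldr (fun Ly (F : GaugeConfig d L (Matrix.specialUnitaryGroup (Fin 2) ℂ) ≃ᵐ GaugeConfig d L (Matrix.specialUnitaryGroup (Fin 2) ℂ)) => Ly.1.trans F) (MeasurableEquiv.refl (GaugeConfig d L (Matrix.specialUnitaryGroup (Fin 2) ℂ)))) ((fun l : Edge d L => expPauli (a l)) * V)) - Real.log ((layers.foldr (fun Ly K => fun v => Ly.2 v * K (Ly.1 v)) (fun _ => (1 : ℝ))) ((fun l : Edge d L => expPauli (a l)) * V))) 0 (Pi.single l (EuclideanSpace.single i (1 : ℝ))))) n (q, p)).1) + su2Kinetic κ' (sunLeapfrogProposalN pauliCoordι pauliCoordι_skew ε' (fun (V : GaugeConfig d L (Matrix.specialUnitaryGroup (Fin 2) ℂ)) (l : Edge d L) => -(ε' / (4 * κ')) • WithLp.toLp 2 (fun i : Fin 3 =>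
        fderiv ℝ (fun a : Edge d L → EuclideanSpace ℝ (Fin 3) => β * wilsonAction (Matrix.specialUnitaryGroup (Fin 2) ℂ).subtype ((layers.foldr (fun Ly (F : GaugeConfig d L (Matrix.specialUnitaryGroup (Fin 2) ℂ) ≃ᵐ GaugeConfig d L (Matrix.specialUnitaryGroup (Fin 2) ℂ)) => Ly.1.trans F) (MeasurableEquiv.refl (GaugeConfig d L (Matrix.specialUnitaryGroup (Fin 2) ℂ)))) ((fun l : Edge d L => expPauli (a l)) * V)) - Real.log ((layers.foldr (fun Ly K => fun v => Ly.2 v * K (Ly.1 v)) (fun _ => (1 : ℝ))) ((fun l : Edge d L => expPauli (a l)) * V))) 0 (Pi.single l (EuclideanSpace.single i (1 : ℝ))))) n (q, p)).2) -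
            (β * wilsonAction (Matrix.specialUnitaryGroup (Fin 2) ℂ).subtype ((layers.foldr (fun Ly (F : GaugeConfig d L (Matrix.specialUnitaryGroup (Fin 2) ℂ) ≃ᵐ GaugeConfig d L (Matrix.specialUnitaryGroup (Fin 2) ℂ)) => Ly.1.trans F) (MeasurableEquiv.refl (GaugeConfig d L (Matrix.specialUnitaryGroup (Fin 2) ℂ)))) q) - Real.log ((layers.foldr (fun Ly K => fun v => Ly.2 v * K (Ly.1 v)) (fun _ => (1 : ℝ))) q) + su2Kinetic κ' p)))) ∂(su2MomentumLaw (ι := Edge d L) κ') := by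
  obtain ⟨hΦm₁, Φmax, KΦ, hΦ0, hK0, hb₁, hK₁⟩ :=
    su2Residual_exactForce_regular χ μf bf cf ρf hρ sched layers hmap hpos β 1
  have hm1 : Measurable (fun (V : GaugeConfig d L (Matrix.specialUnitaryGroup (Fin 2) ℂ)) (l : Edge d L) => WithLp.toLp 2 (fun i : Fin 3 =>
        fderiv ℝ (fun a : Edge d L → EuclideanSpace ℝ (Fin 3) => β * wilsonAction (Matrix.specialUnitaryGroup (Fin 2) ℂ).subtype ((layers.foldr (fun Ly (F : GaugeConfig d L (Matrix.specialUnitaryGroup (Fin 2) ℂ) ≃ᵐ GaugeConfig d L (Matrix.specialUnitaryGroup (Fin 2) ℂ)) => Ly.1.trans F) (MeasurableEquiv.refl (GaugeConfig d L (Matrix.specialUnitaryGroup (Fin 2) ℂ)))) ((fun l : Edge d L => expPauli (a l)) * V)) - Real.log ((layers.foldr (fun Ly K => fun v => Ly.2 v * K (Ly.1 v)) (fun _ => (1 : ℝ))) ((fun l : Edge d L => expPauli (a l)) * V))) 0 (Pi.single l (EuclideanSpace.single i (1 : ℝ))))) := by simpa only [one_smul] using hΦm₁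
  have hb : ∀ (V : GaugeConfig d L (Matrix.specialUnitaryGroup (Fin 2) ℂ)) (l : Edge d L), ‖WithLp.toLp 2 (fun i : Fin 3 =>
        fderiv ℝ (fun a : Edge d L → EuclideanSpace ℝ (Fin 3) => β * wilsonAction (Matrix.specialUnitaryGroup (Fin 2) ℂ).subtype ((layers.foldr (fun Ly (F : GaugeConfig d L (Matrix.specialUnitaryGroup (Fin 2) ℂ) ≃ᵐ GaugeConfig d L (Matrix.specialUnitaryGroup (Fin 2) ℂ)) => Ly.1.trans F) (MeasurableEquiv.refl (GaugeConfig d L (Matrix.specialUnitaryGroup (Fin 2) ℂ)))) ((fun l : Edge d L => expPauli (a l)) * V)) - Real.log ((layers.foldr (fun Ly K => fun v => Ly.2 v * K (Ly.1 v)) (fun _ => (1 : ℝ))) ((fun l : Edge d L => expPauli (a l)) * V))) 0 (Pi.single l (EuclideanSpace.single i (1 : ℝ))))‖ ≤ Φmax :=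
    fun V l => by simpa only [one_smul] using hb₁ V l
  have hK : ∀ V V' : GaugeConfig d L (Matrix.specialUnitaryGroup (Fin 2) ℂ),
      ‖(fun l : Edge d L => WithLp.toLp 2 (fun i : Fin 3 =>
        fderiv ℝ (fun a : Edge d L → EuclideanSpace ℝ (Fin 3) => β * wilsonAction (Matrix.specialUnitaryGroup (Fin 2) ℂ).subtype ((layers.foldr (fun Ly (F : GaugeConfig d L (Matrix.specialUnitaryGroup (Fin 2) ℂ) ≃ᵐ GaugeConfig d L (Matrix.specialUnitaryGroup (Fin 2) ℂ)) => Ly.1.trans F) (MeasurableEquiv.refl (GaugeConfig d L (Matrix.specialUnitaryGroup (Fin 2) ℂ)))) ((fun l : Edge d L => expPauli (a l)) * V)) - Real.log ((layers.foldr (fun Ly K => fun v => Ly.2 v * K (Ly.1 v)) (fun _ => (1 : ℝ))) ((fun l : Edge d L => expPauli (a l)) * V))) 0 (Pi.single l (EuclideanSpace.single i (1 : ℝ))))) - (fun l : Edge d L => WithLp.toLp 2 (fun i : Fin 3 =>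
        fderiv ℝ (fun a : Edge d L → EuclideanSpace ℝ (Fin 3) => β * wilsonAction (Matrix.specialUnitaryGroup (Fin 2) ℂ).subtype ((layers.foldr (fun Ly (F : GaugeConfig d L (Matrix.specialUnitaryGroup (Fin 2) ℂ) ≃ᵐ GaugeConfig d L (Matrix.specialUnitaryGroup (Fin 2) ℂ)) => Ly.1.trans F) (MeasurableEquiv.refl (GaugeConfig d L (Matrix.specialUnitaryGroup (Fin 2) ℂ)))) ((fun l : Edge d L => expPauli (a l)) * V')) - Real.log ((layers.foldr (fun Ly K => fun v => Ly.2 v * K (Ly.1 v)) (fun _ => (1 : ℝ))) ((fun l : Edge d L => expPauli (a l)) * V'))) 0 (Pi.single l (EuclideanSpace.single i (1 : ℝ)))))‖ ≤ KΦ * ‖coeConfig V - coeConfig V'‖ :=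
    fun V V' => by simpa only [one_smul] using hK₁ V V'
  have hd1 : ∀ W : GaugeConfig d L (Matrix.specialUnitaryGroup (Fin 2) ℂ),
      DifferentiableAt ℝ (fun a : Edge d L → EuclideanSpace ℝ (Fin 3) => β * wilsonAction (Matrix.specialUnitaryGroup (Fin 2) ℂ).subtype ((layers.foldr (fun Ly (F : GaugeConfig d L (Matrix.specialUnitaryGroup (Fin 2) ℂ) ≃ᵐ GaugeConfig d L (Matrix.specialUnitaryGroup (Fin 2) ℂ)) => Ly.1.trans F) (MeasurableEquiv.refl (GaugeConfig d L (Matrix.specialUnitaryGroup (Fin 2) ℂ)))) ((fun l : Edge d L => expPauli (a l)) * W)) - Real.log ((layers.foldr (fun Ly K => fun v => Ly.2 v * K (Ly.1 v)) (fun _ => (1 : ℝ))) ((fun l : Edge d L => expPauli (a l)) * W))) 0 :=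
    fun W => differentiableAt_ftAction_su2Residual_pauliDrift χ μf bf cf ρf hρD sched layers hmap hpos β W 0
  -- measurability of the pulled-back action: `β S_W ∘ F` continuous, the running density measurable and positive
  have hρc : Continuous ⇑((Matrix.specialUnitaryGroup (Fin 2) ℂ).subtype) := continuous_subtype_val
  have hS0c : Continuous fun U : GaugeConfig d L (Matrix.specialUnitaryGroup (Fin 2) ℂ) =>
      β * wilsonAction (Matrix.specialUnitaryGroup (Fin 2) ℂ).subtype U := continuous_smul_wilsonAction _ hρc β
  have hFm : Measurable (⇑(layers.foldr (fun Ly (F : GaugeConfig d L (Matrix.specialUnitaryGroup (Fin 2) ℂ) ≃ᵐ GaugeConfig d L (Matrix.specialUnitaryGroup (Fin 2) ℂ)) => Ly.1.trans F) (MeasurableEquiv.refl (GaugeConfig d L (Matrix.specialUnitaryGroup (Fin 2) ℂ))))) := ((layers.foldr (fun Ly (F : GaugeConfig d L (Matrix.specialUnitaryGroup (Fin 2) ℂ) ≃ᵐ GaugeConfig d L (Matrix.specialUnitaryGroup (Fin 2) ℂ)) => Ly.1.trans F) (MeasurableEquiv.refl (GaugeConfig d L (Matrix.specialUnitaryGroup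 (Fin 2) ℂ))))).measurable
  have hJme : Measurable (layers.foldr (fun Ly K => fun v => Ly.2 v * K (Ly.1 v)) (fun _ => (1 : ℝ))) := measurable_foldr_logDet layers hJm
  have hSm : Measurable (fun V : GaugeConfig d L (Matrix.specialUnitaryGroup (Fin 2) ℂ) => β * wilsonAction (Matrix.specialUnitaryGroup (Fin 2) ℂ).subtype ((layers.foldr (fun Ly (F : GaugeConfig d L (Matrix.specialUnitaryGroup (Fin 2) ℂ) ≃ᵐ GaugeConfig d L (Matrix.specialUnitaryGroup (Fin 2) ℂ)) => Ly.1.trans F) (MeasurableEquiv.refl (GaugeConfig d L (Matrix.specialUnitaryGroup (Fin 2) ℂ)))) V) - Real.log ((layers.foldr (fun Ly K => fun v => Ly.2 v * K (Ly.1 v)) (fun _ => (1 : ℝ))) V)) :=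
    (hS0c.measurable.comp hFm).sub hJme.log
  refine ⟨Φmax, KΦ, hΦ0, hK0, fun n ε' q => ?_⟩
  exact su2LeapfrogProposalN_meanAcceptance_ge_of_unitGrad
    (fun V : GaugeConfig d L (Matrix.specialUnitaryGroup (Fin 2) ℂ) => β * wilsonAction (Matrix.specialUnitaryGroup (Fin 2) ℂ).subtype ((layers.foldr (fun Ly (F : GaugeConfig d L (Matrix.specialUnitaryGroup (Fin 2) ℂ) ≃ᵐ GaugeConfig d L (Matrix.specialUnitaryGroup (Fin 2) ℂ)) => Ly.1.trans F) (MeasurableEquiv.refl (GaugeConfig d L (Matrix.specialUnitaryGroup (Fin 2) ℂ)))) V) - Real.log ((layers.foldr (fun Ly K => fun v => Ly.2 v * K (Ly.1 v)) (fun _ => (1 : ℝ))) V)) ε' κ' hκ' hSm hd1 hΦ0 hK0 hm1 hb hK q n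

end Residual

end Summit.Ventures.LatticeQCDFlow.Exactness
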